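import Summits.Schanuel.Schanuel.Theorems.RootDecomp1ETwoScale05

/-!
# RootDecomp1ETwoScale — lens 2, generation 37 «TWO-SCALE E-PLANES» (items 25020 / 31409 of route 1E at n = 4 on `InTwoScaleClass`, mod NW96 Thm 1) — continuation (RootDecomp1ETwoScale06): §4 (T2) the Liouville kernel one level up: `kernel_sum_ne_zero` (FamMeasure + LogPowLiouville kill every two-level relation), `algebraicIndependent_triple_of_famMeasure`, `algebraicIndependent_sigma`

(lens-2 g37 `TwoScale.lean` v2 [HOME/decomp-schanuel-lens-2/g37/TwoScale.lean v2 sha256 e81e28b8…d084, 2853 l (v1 df3b5e32…, 2509 l + §5b); own farm rc 0 · 0 warn · 0 sorry · axioms std; critic VERDICT STATUS L1776 (credit E-R17, PORT GO), v2 ACK L1780]; port by census-1 gen 16 in nine parts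
`RootDecomp1ETwoScale01`–`09` — see the PORT NOTE of part 01; `--supports stmt-Schanuel-31409`; rung 0.)
-/

noncomputable section

open Complex Polynomial IntermediateField Filter

namespace Summit.Schanuel.Schanuel.Theorems.RootDecomp1ETwoScale

open Summit.Schanuel.Schanuel.Theorems.RootDecomp1KHyper
open Summit.Schanuel.Schanuel.Theorems.RootDecomp1KHyper.HyperCell
open Summit.Schanuel.Schanuel.Theorems.RootDecomp1KGeneric
open Literature.NumberTheory.Transcendental (NesterenkoWaldschmidt1996_thm_1 weilHeight₁)

variable {K : ℕ}

section Kernel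

/-- `1 ≤ log x` for `x ≥ 3`. -/
private theorem one_le_log_of_three_le {x : ℝ} (hx : 3 ≤ x) : 1 ≤ Real.log x := by
  rw [Real.le_log_iff_exp_le (by linarith)]
  have := Real.exp_one_lt_d9
  linarith

/-- THE LIOUVILLE KERNEL (relation level). A `FamMeasure` of exponent `e ≥ 1` at `(ρ, w)` and a
`LogPowLiouville (e + 1)` real `σ` admit NO two-level integer relation
`Σ_j σ^j · (Σ_k Gd_{j,k}(ρ) w^k) = 0` with some `Gd_{j,k} ≠ 0`: specialise `σ ↦ r = b/t` at an
approximant with `|σ - r| < exp (-m log^{e+1} t)`, clear `t^J`; the specialised family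
`Gs_k := Σ_j b^j t^{J-j} Gd_{j,k}` is nonzero once `t > len` of a coefficient polynomial, has
`log relLen Gs_k ≪ log t`, and the measure from below beats `t^J · M · |σ - r|` from above. -/
theorem kernel_sum_ne_zero {ρ : ℝ} {w : ℂ} {e : ℕ} (he : 1 ≤ e) (hM : FamMeasure ρ w e K)
    {σ : ℝ} (hσ : LogPowLiouville (e + 1) σ) {J : ℕ} (Gd : Fin (J + 1) → Fin (K + 1) → ℤ[X])
    (hGd : ∃ j k, Gd j k ≠ 0) :
    ∑ j : Fin (J + 1), (σ : ℂ) ^ (j : ℕ) *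
        ∑ k : Fin (K + 1), aeval (ρ : ℂ) (Gd j k) * w ^ (k : ℕ) ≠ 0 := by
  classical
  intro hrel
  -- a uniform degree bound and the measure constant
  obtain ⟨D, hD⟩ : ∃ D : ℕ, ∀ j k, (Gd j k).natDegree ≤ D := by
    refine ⟨Finset.univ.sup fun jk : Fin (J + 1) × Fin (K + 1) => (Gd jk.1 jk.2).natDegree,
      fun j k => ?_⟩
    exact Finset.le_sup (f := fun jk : Fin (J + 1) × Fin (K + 1) => (Gd jk.1 jk.2).natDegree)
      (Finset.mem_univ (j, k))
  obtain ⟨C, hC0, hC⟩ := hM D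
  -- a nonzero coefficient and the coefficient polynomial `π` in the `σ`-variable
  obtain ⟨j₀, k₀, hjk⟩ := hGd
  obtain ⟨i₀, hi₀⟩ : ∃ i, (Gd j₀ k₀).coeff i ≠ 0 := by
    by_contra h
    push Not at h
    exact hjk (Polynomial.ext fun i => by rw [h i, Polynomial.coeff_zero])
  set π : ℤ[X] := ∑ j : Fin (J + 1), Polynomial.C ((Gd j k₀).coeff i₀) * X ^ (j : ℕ) with hπ
  have hπcoeff : ∀ j : Fin (J + 1), π.coeff (j : ℕ) = (Gd j k₀).coeff i₀ := by
    intro j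
    rw [hπ, Polynomial.finsetSum_coeff]
    simp_rw [Polynomial.coeff_C_mul_X_pow]
    rw [Finset.sum_eq_single j, if_pos rfl]
    · intro j' _ hj'
      exact if_neg fun h => hj' (Fin.ext h).symm
    · exact fun h => absurd (Finset.mem_univ j) h
  have hπ0 : π ≠ 0 := fun h => hi₀ (by rw [← hπcoeff j₀, h, Polynomial.coeff_zero])
  have hπdeg : π.natDegree < J + 1 := by
    refine Nat.lt_succ_of_le (Polynomial.natDegree_sum_le_of_forall_le _ _ fun j _ => ?_)
    exact (Polynomial.natDegree_C_mul_X_pow_le _ _).trans (Nat.lt_succ_iff.mp j.2)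
  -- the blocks `A j := Σ_k Gd_{j,k}(ρ) w^k`, the Lipschitz constant `M`, the height datum `H₀`
  set A : Fin (J + 1) → ℂ := fun j => ∑ k : Fin (K + 1), aeval (ρ : ℂ) (Gd j k) * w ^ (k : ℕ)
    with hA
  have hrelA : ∑ j : Fin (J + 1), (σ : ℂ) ^ (j : ℕ) * A j = 0 := hrel
  obtain ⟨M, hMdef⟩ : ∃ M : ℝ,
      M = ∑ j : Fin (J + 1), ((j : ℕ) : ℝ) * (|σ| + 2) ^ (j : ℕ) * ‖A j‖ + 1 := ⟨_, rfl⟩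
  have hM1 : 1 ≤ M := by
    have : 0 ≤ ∑ j : Fin (J + 1), ((j : ℕ) : ℝ) * (|σ| + 2) ^ (j : ℕ) * ‖A j‖ :=
      Finset.sum_nonneg fun j _ => by positivity
    linarith only [this, hMdef]
  obtain ⟨H₀, hH₀def⟩ : ∃ H₀ : ℝ, H₀ = ∑ k : Fin (K + 1), ∑ i ∈ Finset.range (D + 1),
      ∑ j : Fin (J + 1), |((Gd j k).coeff i : ℝ)| + 1 := ⟨_, rfl⟩
  have hH₀1 : 1 ≤ H₀ := by
    have : 0 ≤ ∑ k : Fin (K + 1), ∑ i ∈ Finset.range (D + 1), ∑ j : Fin (J + 1),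
        |((Gd j k).coeff i : ℝ)| :=
      Finset.sum_nonneg fun _ _ => Finset.sum_nonneg fun _ _ => Finset.sum_nonneg fun _ _ =>
        abs_nonneg _
    linarith only [this, hH₀def]
  have hlogH₀ : 0 ≤ Real.log H₀ := Real.log_nonneg hH₀1
  obtain ⟨c₁, hc₁def⟩ : ∃ c₁ : ℝ, c₁ = 1 + (J : ℝ) * (|σ| + 3) + Real.log H₀ := ⟨_, rfl⟩
  have hc₁1 : 1 ≤ c₁ := by
    have : 0 ≤ (J : ℝ) * (|σ| + 3) := by positivity
    linarith only [this, hc₁def, hlogH₀]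
  obtain ⟨m₀, hm₀⟩ : ∃ m₀ : ℝ, m₀ = (J : ℝ) + |Real.log M| + C * c₁ ^ e := ⟨_, rfl⟩
  have hm₀0 : 0 ≤ m₀ := by rw [hm₀]; positivity
  -- the approximant of `σ`
  set m : ℕ := ⌈m₀⌉₊ + (len π).natAbs + 3 with hmdef
  obtain ⟨r, hrden, hσr, hclose⟩ := hσ m
  have hm₀m : m₀ + 3 ≤ m := by
    rw [hmdef]; push_cast
    have := Nat.le_ceil m₀
    have h2 : (0 : ℝ) ≤ ((len π).natAbs : ℕ) := by positivity
    linarith only [this, h2]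
  have hq3 : 3 ≤ r.den := by omega
  have hq3r : (3 : ℝ) ≤ r.den := by exact_mod_cast hq3
  have hq0 : (0 : ℝ) < r.den := by linarith only [hq3r]
  have hlenπ : len π < (r.den : ℤ) := by
    have h1 : len π ≤ ((len π).natAbs : ℤ) := Int.le_natAbs
    have h2 : ((len π).natAbs : ℤ) + 3 ≤ m := by rw [hmdef]; push_cast; omega
    have h3 : (m : ℤ) ≤ r.den := by exact_mod_cast hrden
    omega
  set L : ℝ := Real.log r.den with hL
  have hL1 : 1 ≤ L := one_le_log_of_three_le hq3r
  set s : ℝ := (r : ℝ) with hs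
  have hsC : (r : ℂ) = (s : ℂ) := (Complex.ofReal_ratCast r).symm
  -- |σ - s| ≤ 1, |s| ≤ |σ| + 1, |num| ≤ (|σ| + 1) den
  have hmLpos : 0 ≤ (m : ℝ) * L ^ (e + 1) := by positivity
  have hclose1 : |σ - s| ≤ 1 := by
    refine hclose.le.trans ?_
    rw [Real.exp_le_one_iff]
    linarith only [hmLpos]
  have hsabs : |s| ≤ |σ| + 1 := by
    have := abs_sub_abs_le_abs_sub s σ
    rw [abs_sub_comm] at this
    linarith only [this, hclose1]
  have hnum : |(r.num : ℝ)| ≤ (|σ| + 1) * r.den := by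
    have e1 : (r.num : ℝ) = s * r.den := by
      rw [hs, Rat.cast_def, div_mul_cancel₀ _ hq0.ne']
    rw [e1, abs_mul, abs_of_pos hq0]
    exact mul_le_mul_of_nonneg_right hsabs hq0.le
  obtain ⟨B, hBdef⟩ : ∃ B : ℝ, B = (|σ| + 2) * r.den := ⟨_, rfl⟩
  have hB0 : 0 ≤ B := by rw [hBdef]; positivity
  have hdenB : (r.den : ℝ) ≤ B := by
    rw [hBdef]; nlinarith only [abs_nonneg σ, hq0]
  have hnumB : |(r.num : ℝ)| ≤ B := by
    rw [hBdef]; nlinarith only [hnum, hq0]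
  -- the specialised family `Gs_k := Σ_j num^j den^{J-j} · Gd_{j,k}`
  set c : Fin (J + 1) → ℤ := fun j => r.num ^ (j : ℕ) * (r.den : ℤ) ^ (J - j) with hcdef
  set Gs : Fin (K + 1) → ℤ[X] := fun k => ∑ j : Fin (J + 1), Polynomial.C (c j) * Gd j k
    with hGsdef
  have hcQ : ∀ j : Fin (J + 1), ((c j : ℤ) : ℚ) = (r.den : ℚ) ^ J * (r : ℚ) ^ (j : ℕ) := by
    intro j
    have hj : (j : ℕ) ≤ J := Nat.lt_succ_iff.mp j.2
    have e1 : (r.den : ℚ) ^ J = (r.den : ℚ) ^ (j : ℕ) * (r.den : ℚ) ^ (J - j) := by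
      rw [← pow_add, Nat.add_sub_cancel' hj]
    have e2 : (r : ℚ) * r.den = r.num := Rat.mul_den_eq_num r
    rw [hcdef]; push_cast
    rw [e1, ← e2, mul_pow]; ring
  have hcC : ∀ j : Fin (J + 1), ((c j : ℤ) : ℂ) = (r.den : ℂ) ^ J * (s : ℂ) ^ (j : ℕ) := by
    intro j
    have h1 := congrArg (fun q : ℚ => (q : ℂ)) (hcQ j)
    push_cast at h1
    rw [h1, hsC]
  have hcabs : ∀ j : Fin (J + 1), (|c j| : ℝ) ≤ B ^ J := by
    intro j
    have hj : (j : ℕ) ≤ J := Nat.lt_succ_iff.mp j.2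
    rw [hcdef]; push_cast
    rw [abs_mul, abs_pow, abs_pow, abs_of_pos hq0]
    calc |(r.num : ℝ)| ^ (j : ℕ) * (r.den : ℝ) ^ (J - j) ≤ B ^ (j : ℕ) * B ^ (J - j) :=
          mul_le_mul (pow_le_pow_left₀ (abs_nonneg _) hnumB _)
            (pow_le_pow_left₀ hq0.le hdenB _) (by positivity) (by positivity)
      _ = B ^ J := by rw [← pow_add, Nat.add_sub_cancel' hj]
  -- degrees, evaluation, non-vanishing, length of the specialised family
  have hGsD : ∀ k, (Gs k).natDegree ≤ D := by
    intro k
    rw [hGsdef]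
    refine Polynomial.natDegree_sum_le_of_forall_le _ _ fun j _ => ?_
    exact (Polynomial.natDegree_C_mul_le _ _).trans (hD j k)
  have hGs_aeval : ∀ k, aeval (ρ : ℂ) (Gs k) =
      ∑ j : Fin (J + 1), ((c j : ℤ) : ℂ) * aeval (ρ : ℂ) (Gd j k) := by
    intro k
    rw [hGsdef]
    simp only [map_sum, map_mul, eq_intCast, map_intCast]
  have hGs_eval : ∑ k : Fin (K + 1), aeval (ρ : ℂ) (Gs k) * w ^ (k : ℕ) =
      (r.den : ℂ) ^ J * ∑ j : Fin (J + 1), (s : ℂ) ^ (j : ℕ) * A j := by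
    calc ∑ k : Fin (K + 1), aeval (ρ : ℂ) (Gs k) * w ^ (k : ℕ)
        = ∑ k : Fin (K + 1), ∑ j : Fin (J + 1),
            ((c j : ℤ) : ℂ) * (aeval (ρ : ℂ) (Gd j k) * w ^ (k : ℕ)) := by
          refine Finset.sum_congr rfl fun k _ => ?_
          rw [hGs_aeval, Finset.sum_mul]
          exact Finset.sum_congr rfl fun j _ => by ring
      _ = ∑ j : Fin (J + 1), ((c j : ℤ) : ℂ) * A j := by
          rw [Finset.sum_comm]
          refine Finset.sum_congr rfl fun j _ => ?_
          rw [hA, Finset.mul_sum]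
      _ = (r.den : ℂ) ^ J * ∑ j : Fin (J + 1), (s : ℂ) ^ (j : ℕ) * A j := by
          rw [Finset.mul_sum]
          exact Finset.sum_congr rfl fun j _ => by rw [hcC j]; ring
  have hcoeffQ : (((Gs k₀).coeff i₀ : ℤ) : ℚ) = (r.den : ℚ) ^ J * aeval (r : ℚ) π := by
    have e1 : (Gs k₀).coeff i₀ = ∑ j : Fin (J + 1), c j * (Gd j k₀).coeff i₀ := by
      rw [hGsdef]; simp only [Polynomial.finsetSum_coeff, Polynomial.coeff_C_mul]
    rw [e1, Polynomial.aeval_eq_sum_range' hπdeg,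
      ← Fin.sum_univ_eq_sum_range (fun i => π.coeff i • (r : ℚ) ^ i) (J + 1)]
    push_cast
    rw [Finset.mul_sum]
    refine Finset.sum_congr rfl fun j _ => ?_
    rw [hπcoeff j, zsmul_eq_mul, hcQ j]; ring
  have hGs0 : Gs k₀ ≠ 0 := by
    intro h
    have h1 : (((Gs k₀).coeff i₀ : ℤ) : ℚ) = 0 := by
      rw [h, Polynomial.coeff_zero, Int.cast_zero]
    rw [hcoeffQ] at h1
    rcases mul_eq_zero.mp h1 with h2 | h2
    · exact absurd h2 (pow_ne_zero J (Nat.cast_ne_zero.mpr r.den_pos.ne'))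
    · exact aeval_ne_zero_of_len_lt_den hπ0 hlenπ h2
  have hGs1 : 1 ≤ relLen Gs := by
    have h1 : (1 : ℝ) ≤ (len (Gs k₀) : ℝ) := by exact_mod_cast one_le_len hGs0
    refine h1.trans ?_
    exact Finset.single_le_sum (f := fun k => (len (Gs k) : ℝ))
      (fun k _ => by exact_mod_cast len_nonneg _) (Finset.mem_univ k₀)
  have hrelLen : relLen Gs ≤ B ^ J * H₀ := by
    have h1 : ∀ k, (len (Gs k) : ℝ) ≤
        ∑ i ∈ Finset.range (D + 1), ∑ j : Fin (J + 1), B ^ J * |((Gd j k).coeff i : ℝ)| := by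
      intro k
      have h2 : (len (Gs k) : ℝ) ≤ ∑ i ∈ Finset.range (D + 1), (|(Gs k).coeff i| : ℝ) := by
        exact_mod_cast len_le_of_natDegree_le _ (hGsD k)
      refine h2.trans (Finset.sum_le_sum fun i _ => ?_)
      have e1 : (Gs k).coeff i = ∑ j : Fin (J + 1), c j * (Gd j k).coeff i := by
        rw [hGsdef]; simp only [Polynomial.finsetSum_coeff, Polynomial.coeff_C_mul]
      rw [e1]; push_cast
      refine (Finset.abs_sum_le_sum_abs _ _).trans (Finset.sum_le_sum fun j _ => ?_)
      rw [abs_mul]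
      exact mul_le_mul_of_nonneg_right (hcabs j) (abs_nonneg _)
    have hBJ : 0 ≤ B ^ J := pow_nonneg hB0 J
    calc relLen Gs = ∑ k : Fin (K + 1), (len (Gs k) : ℝ) := rfl
      _ ≤ ∑ k : Fin (K + 1), ∑ i ∈ Finset.range (D + 1), ∑ j : Fin (J + 1),
            B ^ J * |((Gd j k).coeff i : ℝ)| := Finset.sum_le_sum fun k _ => h1 k
      _ = B ^ J * (H₀ - 1) := by
          rw [hH₀def, add_sub_cancel_right, Finset.mul_sum]
          simp_rw [Finset.mul_sum]
      _ ≤ B ^ J * H₀ := by nlinarith only [hBJ]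
  -- the polylog factor: `1 + log relLen Gs ≤ c₁ · L`
  have hfac : 1 + Real.log (relLen Gs) ≤ c₁ * L := by
    have hBpos : 0 < B := lt_of_lt_of_le hq0 hdenB
    have h1 : Real.log (relLen Gs) ≤ (J : ℝ) * Real.log B + Real.log H₀ := by
      have := Real.log_le_log (by linarith only [hGs1]) hrelLen
      rw [Real.log_mul (pow_ne_zero J hBpos.ne') (by linarith only [hH₀1]), Real.log_pow] at this
      exact this
    have h2 : Real.log B = Real.log (|σ| + 2) + L := by
      rw [hBdef, Real.log_mul (by positivity) hq0.ne']
    have h3 : Real.log (|σ| + 2) ≤ |σ| + 2 := by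
      have := Real.log_le_sub_one_of_pos (show (0 : ℝ) < |σ| + 2 by positivity)
      linarith only [this]
    have hJ0 : (0 : ℝ) ≤ J := Nat.cast_nonneg J
    have h4 : (J : ℝ) * Real.log B ≤ (J : ℝ) * (|σ| + 3) * L := by
      rw [h2]
      have h5 : Real.log (|σ| + 2) + L ≤ (|σ| + 3) * L := by nlinarith only [h3, hL1, abs_nonneg σ]
      nlinarith only [h5, hJ0]
    have h6 : Real.log H₀ ≤ Real.log H₀ * L := le_mul_of_one_le_right hlogH₀ hL1
    rw [hc₁def]
    nlinarith only [h1, h4, h6, hL1, hlogH₀, hJ0]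
  -- from below: the measure
  have hlow := hC Gs ⟨k₀, hGs0⟩ hGsD
  -- from above: Lipschitz in the `σ`-variable
  have hF : ‖∑ j : Fin (J + 1), (s : ℂ) ^ (j : ℕ) * A j‖ ≤ M * |σ - s| := by
    have e1 : ∑ j : Fin (J + 1), (s : ℂ) ^ (j : ℕ) * A j =
        ∑ j : Fin (J + 1), ((s : ℂ) ^ (j : ℕ) - (σ : ℂ) ^ (j : ℕ)) * A j := by
      rw [← sub_zero (∑ j : Fin (J + 1), (s : ℂ) ^ (j : ℕ) * A j), ← hrelA,
        ← Finset.sum_sub_distrib]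
      exact Finset.sum_congr rfl fun j _ => by ring
    rw [e1]
    have hmax : ∀ j : Fin (J + 1),
        ‖(s : ℂ) ^ (j : ℕ) - (σ : ℂ) ^ (j : ℕ)‖ ≤ (j : ℕ) * (|σ| + 2) ^ (j : ℕ) * |σ - s| := by
      intro j
      have h1 := norm_pow_sub_pow_le (s : ℂ) (σ : ℂ) j
      have h2 : max 1 (max ‖(s : ℂ)‖ ‖(σ : ℂ)‖) ≤ |σ| + 2 := by
        rw [Complex.norm_real, Complex.norm_real, Real.norm_eq_abs, Real.norm_eq_abs]
        refine max_le (by linarith only [abs_nonneg σ]) (max_le ?_ ?_)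
        · linarith only [hsabs]
        · linarith only [abs_nonneg σ]
      have h3 : (max 1 (max ‖(s : ℂ)‖ ‖(σ : ℂ)‖)) ^ (j : ℕ) ≤ (|σ| + 2) ^ (j : ℕ) :=
        pow_le_pow_left₀ (le_trans zero_le_one (le_max_left _ _)) h2 _
      have h4 : ‖(s : ℂ) - σ‖ = |σ - s| := by
        rw [← Complex.ofReal_sub, Complex.norm_real, Real.norm_eq_abs, abs_sub_comm]
      rw [h4] at h1
      refine h1.trans ?_
      have h5 : (0 : ℝ) ≤ (j : ℕ) := Nat.cast_nonneg _
      have h6 : 0 ≤ |σ - s| := abs_nonneg _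
      exact mul_le_mul_of_nonneg_right (mul_le_mul_of_nonneg_left h3 h5) h6
    calc ‖∑ j : Fin (J + 1), ((s : ℂ) ^ (j : ℕ) - (σ : ℂ) ^ (j : ℕ)) * A j‖
        ≤ ∑ j : Fin (J + 1), ‖((s : ℂ) ^ (j : ℕ) - (σ : ℂ) ^ (j : ℕ)) * A j‖ := norm_sum_le _ _
      _ ≤ ∑ j : Fin (J + 1), ((j : ℕ) * (|σ| + 2) ^ (j : ℕ) * |σ - s|) * ‖A j‖ := by
          refine Finset.sum_le_sum fun j _ => ?_
          rw [norm_mul]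
          exact mul_le_mul_of_nonneg_right (hmax j) (norm_nonneg _)
      _ = (M - 1) * |σ - s| := by rw [hMdef, add_sub_cancel_right, Finset.sum_mul]; exact Finset.sum_congr rfl fun j _ => by ring
      _ ≤ M * |σ - s| := by nlinarith only [abs_nonneg (σ - s)]
  -- comparison
  set Le : ℝ := L ^ e with hLe
  set Le1 : ℝ := L ^ (e + 1) with hLe1
  have hLe1le : 1 ≤ Le := one_le_pow₀ hL1
  have hLLe : L ≤ Le := by
    rw [hLe]; calc L = L ^ 1 := (pow_one L).symm
      _ ≤ L ^ e := pow_le_pow_right₀ hL1 he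
  have hLeLe1 : Le ≤ Le1 := by rw [hLe, hLe1]; exact pow_le_pow_right₀ hL1 (Nat.le_succ e)
  have hup : ‖∑ k : Fin (K + 1), aeval (ρ : ℂ) (Gs k) * w ^ (k : ℕ)‖ ≤
      Real.exp ((J : ℝ) * L + Real.log M - m * Le1) := by
    rw [hGs_eval, norm_mul, norm_pow, Complex.norm_natCast]
    have e1 : Real.exp ((J : ℝ) * L + Real.log M - m * Le1) =
        (r.den : ℝ) ^ J * (M * Real.exp (-(m * Le1))) := by
      rw [sub_eq_add_neg, Real.exp_add, Real.exp_add, Real.exp_log (by linarith only [hM1]),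
        hL, Real.exp_nat_mul, Real.exp_log hq0]; ring
    rw [e1]
    refine mul_le_mul_of_nonneg_left ?_ (by positivity)
    refine hF.trans (mul_le_mul_of_nonneg_left ?_ (by linarith only [hM1]))
    rw [hLe1, hL]; exact hclose.le
  have hdown : Real.exp (-(C * c₁ ^ e * Le)) ≤
      ‖∑ k : Fin (K + 1), aeval (ρ : ℂ) (Gs k) * w ^ (k : ℕ)‖ := by
    refine le_trans ?_ hlow
    rw [Real.exp_le_exp, neg_le_neg_iff]
    have h0 : 0 ≤ 1 + Real.log (relLen Gs) := by
      have := Real.log_nonneg hGs1; linarith only [this]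
    have h1 : (1 + Real.log (relLen Gs)) ^ e ≤ (c₁ * L) ^ e := pow_le_pow_left₀ h0 hfac e
    rw [mul_pow, ← hLe] at h1
    nlinarith only [h1, hC0.le]
  have hcmp := Real.exp_le_exp.mp (hdown.trans hup)
  -- the final inequality
  have hJ0 : (0 : ℝ) ≤ J := Nat.cast_nonneg J
  have hm0 : (0 : ℝ) ≤ m := Nat.cast_nonneg m
  have h1 : (J : ℝ) * L ≤ (J : ℝ) * Le := mul_le_mul_of_nonneg_left hLLe hJ0
  have h2 : Real.log M ≤ |Real.log M| * Le :=
    (le_abs_self _).trans (le_mul_of_one_le_right (abs_nonneg _) hLe1le)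
  have h3 : (m : ℝ) * Le ≤ (m : ℝ) * Le1 := mul_le_mul_of_nonneg_left hLeLe1 hm0
  have h4 : (m₀ + 3) * Le ≤ (m : ℝ) * Le := mul_le_mul_of_nonneg_right hm₀m (by linarith only [hLe1le])
  have h5 : m₀ * Le = (J : ℝ) * Le + |Real.log M| * Le + C * c₁ ^ e * Le := by rw [hm₀]; ring
  nlinarith only [hcmp, h1, h2, h3, h4, h5, hLe1le]

/-- A level-`0` `FamMeasure` forbids `g(ρ) = 0` for nonzero `g ∈ ℤ[X]`. -/
theorem aeval_ne_zero_of_famMeasure {ρ : ℝ} {w : ℂ} {e : ℕ} (hM : FamMeasure ρ w e 0)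
    {g : ℤ[X]} (hg : g ≠ 0) : aeval (ρ : ℂ) g ≠ 0 := by
  intro h0
  obtain ⟨C, hC0, hC⟩ := hM g.natDegree
  have h := hC (fun _ => g) ⟨0, hg⟩ (fun _ => le_rfl)
  have hsum : ∑ k : Fin (0 + 1), aeval (ρ : ℂ) ((fun _ : Fin (0 + 1) => g) k) * w ^ (k : ℕ) = 0 := by
    simp [h0]
  rw [hsum, norm_zero] at h
  exact absurd h (not_le.mpr (Real.exp_pos _))

/-- … hence `ρ` is transcendental. -/
theorem transcendental_of_famMeasure {ρ : ℝ} {w : ℂ} {e : ℕ} (hM : FamMeasure ρ w e 0) :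
    Transcendental ℚ (ρ : ℂ) := by
  intro halg
  obtain ⟨g, hg0, hg⟩ := (IsFractionRing.isAlgebraic_iff ℤ ℚ ℂ).mpr halg
  exact aeval_ne_zero_of_famMeasure hM hg0 hg

/-- A `FamMeasure` at every level makes `(ρ, w)` algebraically independent. -/
theorem algebraicIndependent_pair_of_famMeasure {ρ : ℝ} {w : ℂ} {e : ℕ}
    (hM : ∀ K, FamMeasure ρ w e K) : AlgebraicIndependent ℚ ![(ρ : ℂ), w] := by
  by_contra hdep
  obtain ⟨K, G, hGK, hrel⟩ := exists_int_relation (transcendental_of_famMeasure (hM 0)) hdep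
  obtain ⟨D, hD⟩ : ∃ D, ∀ k, (G k).natDegree ≤ D :=
    ⟨Finset.univ.sup fun k => (G k).natDegree,
      fun k => Finset.le_sup (f := fun k => (G k).natDegree) (Finset.mem_univ k)⟩
  obtain ⟨C, hC0, hC⟩ := hM K D
  have h := hC G ⟨Fin.last K, hGK⟩ hD
  rw [hrel, norm_zero] at h
  exact absurd h (not_le.mpr (Real.exp_pos _))

/-- THE KERNEL AT LEVEL 0 (hypothesis-free input): a level-`0` `FamMeasure` for `ρ` of exponent
`e ≥ 1` and a `LogPowLiouville (e + 1)` real `σ` make `(ρ, σ)` algebraically independent. -/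
theorem algebraicIndependent_sigma_of_famMeasure {ρ : ℝ} {w : ℂ} {e : ℕ} (he : 1 ≤ e)
    (hM : FamMeasure ρ w e 0) {σ : ℝ} (hσ : LogPowLiouville (e + 1) σ) :
    AlgebraicIndependent ℚ ![(ρ : ℂ), (σ : ℂ)] := by
  by_contra hdep
  obtain ⟨J, G, hGJ, hrel⟩ := exists_int_relation (transcendental_of_famMeasure hM) hdep
  refine kernel_sum_ne_zero he hM hσ (fun j _ => G j) ⟨Fin.last J, 0, hGJ⟩ ?_
  rw [← hrel]
  refine Finset.sum_congr rfl fun j _ => ?_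
  simp [mul_comm]

/-- Elements of `ℚ[b, c]` are `Σ_{k ≤ K} g_k(b) c^k` with `g_k ∈ ℚ[X]`, for every large `K`. -/
theorem exists_rep_of_mem_adjoin_pair {b c z : ℂ} (hz : z ∈ Algebra.adjoin ℚ ({b, c} : Set ℂ)) :
    ∃ K₀ : ℕ, ∀ K : ℕ, K₀ ≤ K → ∃ g : Fin (K + 1) → ℚ[X],
      z = ∑ k : Fin (K + 1), aeval b (g k) * c ^ (k : ℕ) := by
  classical
  rw [Set.insert_eq, Algebra.adjoin_union_eq_adjoin_adjoin, Subalgebra.mem_restrictScalars] at hz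
  set A₁ := Algebra.adjoin ℚ ({b} : Set ℂ) with hA₁
  rw [Algebra.adjoin_singleton_eq_range_aeval A₁ c, AlgHom.mem_range] at hz
  obtain ⟨p, rfl⟩ := hz
  have hcoef : ∀ i : ℕ, ∃ g : ℚ[X], aeval b g = ((p.coeff i : A₁) : ℂ) := by
    intro i
    have hm : ((p.coeff i : A₁) : ℂ) ∈ (Polynomial.aeval b : ℚ[X] →ₐ[ℚ] ℂ).range :=
      (Algebra.adjoin_singleton_eq_range_aeval ℚ b).le (p.coeff i).2
    exact (AlgHom.mem_range _).1 hm
  choose g hg using hcoef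
  refine ⟨p.natDegree, fun K hK => ⟨fun k => g k, ?_⟩⟩
  have h1 : (aeval c p : ℂ) = ∑ i ∈ Finset.range (K + 1), ((p.coeff i : A₁) : ℂ) * c ^ i := by
    rw [Polynomial.aeval_def, Polynomial.eval₂_eq_sum_range' (algebraMap A₁ ℂ)
      (Nat.lt_succ_of_le hK)]
    rfl
  rw [h1, ← Fin.sum_univ_eq_sum_range (fun i => ((p.coeff i : A₁) : ℂ) * c ^ i) (K + 1)]
  exact Finset.sum_congr rfl fun k _ => by rw [hg]

end Kernel

end Summit.Schanuel.Schanuel.Theorems.RootDecomp1ETwoScale
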